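import Summits.Ventures.PercRepro.RankLevelSetFourCircuitNullityTwo

/-!
# PercRepro — THE NULLITY-3 TOTAL CAP `s₄ ≤ 8` ON EVERY `e`-FREE CORE (p8 g7, S3)

`proofs/P8-S3-NULLITY3.md`. (L2) A `U₃,₅` (a 5-set whose 4-subsets are all circuits) is CLOSED in a core: a point
`z ∈ cl(P) ∖ P` is not `e`-free, since every partition of `E ∖ z` puts three points of `P` on one side and they span
`cl(P) ∋ z` (`closure_eq_self_of_five`). (L3) At nullity `3`, `s₄ ≥ 9` gives, for every non-coloop `y`,
`s₄(M ∖ y) ≥ 9 − Q*(3) = 4`, hence (L1, RankLevelSetFourCircuitNullityTwo) a `P_y` avoiding `y` carrying every quad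
avoiding `y`; with `y₂ ∈ P_{y₁}` the quad `P_{y₁} ∖ y₂` lies in `P_{y₂} = (P_{y₁} ∖ y₂) ∪ {z}` and
`z ∈ cl(P_{y₁} ∖ y₂) = P_{y₁}`, a contradiction: **`s₄ ≤ 8` on every `e`-free core of nullity `3`**
(`ncard_fourCircuits_le_eight_of_nullity_three`; the tree's `capKer 3 = 10`, the census maximum `7`). The nullity-`4`
cap `16` and the chain from it are in RankLevelSetFourCircuitNullityFour. Axioms: standard.
-/

open scoped Matroid

namespace PercRepro

namespace ThmN

open Set

variable {α : Type}

/-- **L2 — a `U₃,₅` is closed in a core**: a point `z ∈ cl(P) ∖ P` would not be `e`-free (every partition of `E ∖ z`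
puts three points of `P` on one side, and three points of `P` span `cl(P) ∋ z`). -/
theorem closure_eq_self_of_five (M : Matroid α) [M.Finite]
    (hfree : ∀ e ∈ M.E, ∃ A ⊆ M.E \ {e}, e ∉ M.closure A ∧ e ∉ M.closure ((M.E \ {e}) \ A))
    {P : Set α} (hP : P ⊆ M.E) (h5 : P.ncard = 5) (hq : ∀ S ⊆ P, S.ncard = 4 → M.IsCircuit S) :
    M.closure P = P := by
  have hfP : P.Finite := M.ground_finite.subset hP
  refine subset_antisymm ?_ (M.subset_closure P hP)
  intro z hz
  by_contra hzP
  have hzE : z ∈ M.E := M.closure_subset_ground P hz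
  -- the rank of `P` is `3`: `P ⊆ cl(T)` for any 4-subset `T`
  have hrP : M.eRk P = 3 := by
    obtain ⟨T, hTP, hT4⟩ := Set.exists_subset_card_eq (s := P) (n := 4) (by omega)
    have hT : M.IsCircuit T := hq T hTP hT4
    have hfT : T.Finite := hfP.subset hTP
    have hPcl : P ⊆ M.closure T := by
      intro p hp
      by_cases hpT : p ∈ T
      · exact M.subset_closure T (hTP.trans hP) hpT
      · obtain ⟨t, ht⟩ : T.Nonempty := by rw [← Set.ncard_pos hfT, hT4]; norm_num
        have hT' : M.IsCircuit (insert p (T \ {t})) := hq _ (insert_subset hp (sdiff_subset.trans hTP)) (by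
          rw [Set.ncard_insert_of_notMem (fun h => hpT h.1) (hfT.sdiff), Set.ncard_sdiff_singleton_of_mem ht, hT4])
        have hmem := hT'.mem_closure_sdiff_singleton_of_mem (mem_insert p _)
        refine M.closure_subset_closure ?_ hmem
        intro y hy
        obtain ⟨hy1, hy2⟩ := hy
        rcases hy1 with hy1 | hy1
        · exact absurd (mem_singleton_iff.2 hy1) hy2
        · exact hy1.1
    have h1 : M.eRk P ≤ M.eRk T := by
      have := M.eRk_mono hPcl
      rwa [M.eRk_closure_eq] at this
    have h2 : M.eRk T ≤ M.eRk P := M.eRk_mono hTP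
    have hT3 := hT.eRk_add_one_eq
    rw [← hfT.cast_ncard_eq, hT4] at hT3
    obtain ⟨r, hr⟩ := eRk_eq_nat_of_subset M (hTP.trans hP)
    rw [hr] at hT3 h1 h2
    have : r + 1 = 4 := by exact_mod_cast hT3
    have hr3 : r = 3 := by omega
    subst hr3
    exact le_antisymm h1 h2
  -- any set `B ⊆ E ∖ {z}` holding three points of `P` has `z ∈ cl(B)`
  have key : ∀ B ⊆ M.E \ {z}, 3 ≤ (P ∩ B).ncard → z ∈ M.closure B := by
    intro B hB h3
    obtain ⟨S, hSPB, hS3⟩ := Set.exists_subset_card_eq (s := P ∩ B) (n := 3) h3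
    have hSP : S ⊆ P := hSPB.trans inter_subset_left
    have hSB : S ⊆ B := hSPB.trans inter_subset_right
    obtain ⟨T, hST, hTP, hT4⟩ := Set.exists_subsuperset_card_eq (s := S) (t := P) (n := 4) hSP (by omega) (by omega)
    have hT : M.IsCircuit T := hq T hTP hT4
    have hSind : M.Indep S := hT.ssubset_indep ⟨hST, fun h => by
      have := Set.ncard_le_ncard h (hfP.subset hSP)
      omega⟩
    have hrS : M.eRk S = 3 := by
      rw [hSind.eRk_eq_encard, ← (hfP.subset hSP).cast_ncard_eq, hS3]; rfl
    have hrcl : M.eRk (M.closure P) ≤ M.eRk S := by rw [M.eRk_closure_eq, hrP, hrS]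
    have hcl := S1.closure_eq_closure_of_subset_closure_of_eRk_le M (hSP.trans (M.subset_closure P hP)) hrcl
      (by rw [hrS]; exact ENat.coe_ne_top 3)
    rw [← hcl] at hz
    exact M.closure_subset_closure hSB hz
  obtain ⟨A, hA, hzA, hzA'⟩ := hfree z hzE
  have hPz : P ⊆ M.E \ {z} := fun p hp => ⟨hP hp, fun h => hzP (mem_singleton_iff.1 h ▸ hp)⟩
  have hsplit : (P ∩ A).ncard + (P ∩ ((M.E \ {z}) \ A)).ncard = 5 := by
    have e : (P ∩ A) ∪ (P ∩ ((M.E \ {z}) \ A)) = P := by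
      rw [← inter_union_distrib_left, union_sdiff_cancel hA]
      exact inter_eq_left.2 hPz
    have hdisj : (P ∩ A) ∩ (P ∩ ((M.E \ {z}) \ A)) = ∅ := by
      ext x; simp only [mem_inter_iff, mem_sdiff, mem_empty_iff_false, iff_false, not_and]; tauto
    have hu := ncard_union_add_ncard_inter (P ∩ A) (P ∩ ((M.E \ {z}) \ A)) (hfP.subset inter_subset_left)
      (hfP.subset inter_subset_left)
    rw [e, hdisj, Set.ncard_empty, h5] at hu
    omega
  rcases le_or_gt 3 (P ∩ A).ncard with h | h
  · exact hzA (key A hA h)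
  · exact hzA' (key _ sdiff_subset (by omega))

/-- Deleting a non-coloop lowers the nullity by one (the dual-rank bookkeeping of RankLevelSetFiveCircuitAvg). -/
theorem delete_nullity_of_nonColoop (M : Matroid α) [M.Finite] {d : ℕ} (hd : M.E.encard = M.eRank + (d + 1))
    {y : α} (hy : y ∈ M.E) (hyc : ¬ M.IsColoop y) : (M ＼ {y}).E.encard = (M ＼ {y}).eRank + d := by
  have hν : M✶.eRank = ((d + 1 : ℕ) : ℕ∞) := by
    have h := _root_.Matroid.eRank_add_eRank_dual M
    rw [hd] at h
    exact WithTop.add_left_cancel (PercRepro.Matroid.eRank_ne_top_of_finite M) h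
  have hdel := PercRepro.Matroid.dual_eRank_delete_singleton_add_one hy hyc
  rw [hν] at hdel
  have hfin' : (M ＼ {y})✶.eRank ≠ ⊤ := by
    intro h
    rw [h] at hdel
    have h2 : ((d + 1 : ℕ) : ℕ∞) = ⊤ := by rw [← hdel]; simp
    exact ENat.coe_ne_top _ h2
  obtain ⟨d', hd'⟩ := ENat.ne_top_iff_exists.1 hfin'
  have hdd' : d = d' := by
    rw [← hd'] at hdel
    have : d' + 1 = d + 1 := by exact_mod_cast hdel
    omega
  subst hdd'
  have h := _root_.Matroid.eRank_add_eRank_dual (M ＼ {y})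
  rw [← hd'] at h
  exact h.symm

/-- **L3 — `s₄ ≤ 8` on every `e`-free core of nullity `3`** (the tree's `capKer 3 = 10`): with `s₄ ≥ 9` every non-coloop
`y` leaves `s₄(M ∖ y) ≥ 9 − Q*(3) = 4` on the nullity-`2` core `M ∖ y`, hence a `U₃,₅` avoiding `y` carrying every quad
avoiding `y`; for `y₂ ∈ P_{y₁}` the quad `P_{y₁} ∖ y₂` lies in `P_{y₂} = (P_{y₁} ∖ y₂) ∪ {z}`, and `z ∈ cl(P_{y₁} ∖ y₂) ⊆
cl(P_{y₁}) = P_{y₁}` (L2) although `z ∉ P_{y₁}`. -/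
theorem ncard_fourCircuits_le_eight_of_nullity_three (M : Matroid α) [M.Finite]
    (hfree : ∀ e ∈ M.E, ∃ A ⊆ M.E \ {e}, e ∉ M.closure A ∧ e ∉ M.closure ((M.E \ {e}) \ A))
    (hd : M.E.encard = M.eRank + 3) : {C : Set α | M.IsCircuit C ∧ C.ncard = 4}.ncard ≤ 8 := by
  by_contra hlt
  have h9 : 9 ≤ {C : Set α | M.IsCircuit C ∧ C.ncard = 4}.ncard := by omega
  have hd' : M.E.encard = M.eRank + ((2 : ℕ) + 1) := by rw [hd]; norm_num
  -- for every non-coloop `y`: a `U₃,₅` avoiding `y` carrying every quad avoiding `y`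
  have step : ∀ y ∈ M.E, ¬ M.IsColoop y → ∃ P ⊆ M.E \ {y}, P.ncard = 5 ∧
      (∀ S ⊆ P, S.ncard = 4 → M.IsCircuit S) ∧ ∀ C, M.IsCircuit C → C.ncard = 4 → y ∉ C → C ⊆ P := by
    intro y hy hyc
    have hsplit := S1.ncard_fourCircuits_le_through_add_delete M y
    have hq := S1.ncard_fourCircuitsThrough_le_qKer 3 M hfree (by exact_mod_cast hd) y hy
    have hq5 : S1.qKer 3 = 5 := by decide
    rw [hq5] at hq
    have h4 : 4 ≤ {C : Set α | (M ＼ {y}).IsCircuit C ∧ C.ncard = 4}.ncard := by omega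
    have hfree' := S1.hfree_delete M hfree y
    have hd2 : (M ＼ {y}).E.encard = (M ＼ {y}).eRank + 2 :=
      delete_nullity_of_nonColoop M hd' hy hyc
    obtain ⟨P, hPE, hP5, hPq, hPall⟩ := exists_five_of_four_le_ncard_fourCircuits (M ＼ {y}) hfree' hd2 h4
    refine ⟨P, by rwa [_root_.Matroid.delete_ground] at hPE, hP5, fun S hS hS4 => (hPq S hS hS4).of_delete,
      fun C hC hC4 hyC => hPall C (_root_.Matroid.delete_isCircuit_iff.2 ⟨hC, disjoint_singleton_right.2 hyC⟩) hC4⟩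
  -- `y₁`: a point of some quad
  have hQfin := fourCircuits_finite M
  obtain ⟨C₀, hC₀⟩ : {C : Set α | M.IsCircuit C ∧ C.ncard = 4}.Nonempty := by
    rw [← Set.ncard_pos hQfin]; omega
  have hC₀4 : C₀.ncard = 4 := hC₀.2
  obtain ⟨y₁, hy₁C⟩ : C₀.Nonempty := by
    rw [← Set.ncard_pos (M.ground_finite.subset hC₀.1.subset_ground), hC₀4]; norm_num
  obtain ⟨P₁, hP₁E, hP₁5, hP₁q, hP₁all⟩ := step y₁ (hC₀.1.subset_ground hy₁C) (hC₀.1.not_isColoop_of_mem hy₁C)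
  have hP₁E' : P₁ ⊆ M.E := hP₁E.trans sdiff_subset
  have hfP₁ : P₁.Finite := M.ground_finite.subset hP₁E'
  -- `y₂ ∈ P₁`, a non-coloop (it lies on the quad `P₁ ∖ {w}`)
  obtain ⟨y₂, hy₂⟩ : P₁.Nonempty := by rw [← Set.ncard_pos hfP₁, hP₁5]; norm_num
  obtain ⟨w, hw, hwy⟩ := Set.exists_ne_of_one_lt_ncard (show 1 < P₁.ncard by omega) y₂
  have hCw : M.IsCircuit (P₁ \ {w}) := hP₁q _ sdiff_subset (by rw [Set.ncard_sdiff_singleton_of_mem hw, hP₁5])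
  have hy₂c : ¬ M.IsColoop y₂ := hCw.not_isColoop_of_mem ⟨hy₂, fun h => hwy (mem_singleton_iff.1 h).symm⟩
  obtain ⟨P₂, hP₂E, hP₂5, hP₂q, hP₂all⟩ := step y₂ (hP₁E' hy₂) hy₂c
  have hfP₂ : P₂.Finite := M.ground_finite.subset (hP₂E.trans sdiff_subset)
  -- the quad `T = P₁ ∖ {y₂}` avoids `y₂`, so it lies in `P₂`
  have hT4 : (P₁ \ {y₂}).ncard = 4 := by rw [Set.ncard_sdiff_singleton_of_mem hy₂, hP₁5]
  have hT : M.IsCircuit (P₁ \ {y₂}) := hP₁q _ sdiff_subset hT4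
  have hTP₂ : P₁ \ {y₂} ⊆ P₂ := hP₂all _ hT hT4 (fun h => h.2 (mem_singleton y₂))
  -- the fifth point `z` of `P₂`
  obtain ⟨z, hzP₂, hzT⟩ : (P₂ \ (P₁ \ {y₂})).Nonempty := by
    rw [← Set.ncard_pos (hfP₂.sdiff), Set.ncard_sdiff hTP₂ (hfP₁.sdiff), hP₂5, hT4]; norm_num
  have hzy₂ : z ≠ y₂ := fun h => (hP₂E hzP₂).2 (h ▸ mem_singleton y₂)
  have hzP₁ : z ∉ P₁ := fun h => hzT ⟨h, fun h' => hzy₂ (mem_singleton_iff.1 h')⟩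
  -- `z ∈ cl(P₁ ∖ {y₂})` by the quad `insert z ((P₁ ∖ {y₂}) ∖ {t})` of `P₂`
  obtain ⟨t, ht⟩ : (P₁ \ {y₂}).Nonempty := by rw [← Set.ncard_pos (hfP₁.sdiff), hT4]; norm_num
  have hq' : M.IsCircuit (insert z ((P₁ \ {y₂}) \ {t})) :=
    hP₂q _ (insert_subset hzP₂ (sdiff_subset.trans hTP₂)) (by
      rw [Set.ncard_insert_of_notMem (fun h => hzT h.1) ((hfP₁.sdiff).sdiff), Set.ncard_sdiff_singleton_of_mem ht, hT4])
  have hzcl : z ∈ M.closure (P₁ \ {y₂}) := by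
    have hmem := hq'.mem_closure_sdiff_singleton_of_mem (mem_insert z _)
    refine M.closure_subset_closure ?_ hmem
    intro y hy
    obtain ⟨hy1, hy2⟩ := hy
    rcases hy1 with hy1 | hy1
    · exact absurd (mem_singleton_iff.2 hy1) hy2
    · exact hy1.1
  have hcl : M.closure P₁ = P₁ := closure_eq_self_of_five M hfree hP₁E' hP₁5 hP₁q
  have hz : z ∈ M.closure P₁ := M.closure_subset_closure sdiff_subset hzcl
  rw [hcl] at hz
  exact hzP₁ hz

end ThmN

end PercRepro
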